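import Literature.NumberTheory.Sieve.LargestPrimeFactorCubicSetup
import HarnessLib

/-!
# Heath-Brown 2001 (PLMS), §8 p. 31: a `q < N^{22/7}` is counted at most three times in `∑_{q₁,q₂} C(q₁q₂)`

Topic `Literature/NumberTheory/Sieve`; a PROVED counting layer (no named facts) under the named fact
`Irving2015_largestPrimeFactor_cubic` (`LargestPrimeFactorCubic.lean`), an input of the main-term
assembly (Lemma 8).  Source: D. R. Heath-Brown, *The largest prime factor of `X³ + 2`*, Proc. London
Math. Soc. (3) 82 (2001) 554–596, §8 p. 31: "We now observe that if `q ≪ N³` has `m` distinct prime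
divisors in the range `N^{5/7} < p ≤ N^{5/7+δ}`, and `n` in the range `N^{6/7} < p ≤ N^{6/7+δ}`, then
`mn ≤ 3`.  It follows that `q` can be counted with multiplicity at most `3` in the sum `∑_{q₁,q₂}
C(q₁q₂)`."  (With the parallel seat's ranges `q1Range X`, `q2Range X` of `…Setup`, `N = Npar X`.)

PROVED here:

* `five_mul_add_six_mul_lt` — the arithmetic: `5m + 6n < 22 ⇒ mn ≤ 3`;
* `card_q1_dvd_mul_card_q2_dvd_le` — if `0 < q` and `q < N^{22/7}` then, with
  `m = #{q₁ ∈ q1Range : q₁ ∣ q}`, `n = #{q₂ ∈ q2Range : q₂ ∣ q}`, one has `mn ≤ 3` (the product of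
  these distinct primes divides `q` and exceeds `N^{5m/7 + 6n/7}`);
* **`card_pairs_dvd_le_three`** — `#{(q₁, q₂) ∈ q1Range × q2Range : q₁q₂ ∣ q} ≤ 3` for such `q`.

## References

* D. R. Heath-Brown, *The largest prime factor of `X³ + 2`*, Proc. London Math. Soc. (3) 82 (2001)
  554–596, §8 p. 31. [`HeathBrown2001LargestPrimeFactorCubic`]

## Mathlib / tree search

Tree: `LargestPrimeFactorCubic.q1Range`, `q2Range`, `Npar`, `Npar_nonneg`, `hbδ`, `hbδ_pos`, `hbδ_lt`
(`…Setup`).  Mathlib: `Finset.prod_primes_dvd`, `Nat.prime_iff`, `Finset.prod_le_prod`,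
`Real.rpow_natCast`, `Real.rpow_add`, `Finset.card_le_card`.
-/

noncomputable section

open Finset Real

namespace Literature.NumberTheory.Sieve.HeathBrown2001

open LargestPrimeFactorCubic

/-- The arithmetic of p. 31: `5m + 6n < 22 ⇒ mn ≤ 3`. [cite: HeathBrown2001LargestPrimeFactorCubic, §8 p. 31] -/
theorem five_mul_add_six_mul_lt {m n : ℕ} (h : 5 * m + 6 * n < 22) : m * n ≤ 3 := by
  have hm : m ≤ 4 := by omega
  have hn : n ≤ 3 := by omega
  interval_cases m <;> interval_cases n <;> omega

/-- A product of distinct primes from `q1Range ∪ q2Range` dividing `q` is `> N^{5m/7} N^{6n/7}`. [folklore] -/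
theorem rpow_lt_of_primes_dvd {X q : ℕ} (hq : 0 < q) (S₁ : Finset ℕ) (S₂ : Finset ℕ)
    (h₁ : S₁ ⊆ (q1Range X).filter (· ∣ q)) (h₂ : S₂ ⊆ (q2Range X).filter (· ∣ q)) :
    Npar X ^ ((5 : ℝ) / 7 * #S₁ + (6 : ℝ) / 7 * #S₂) ≤ q := by
  classical
  have hN := Npar_nonneg X
  -- the primes are distinct (the ranges are disjoint) and all divide `q`
  have hdisj : Disjoint S₁ S₂ := by
    rw [disjoint_left]
    intro p hp1 hp2
    have a1 := h₁ hp1; have a2 := h₂ hp2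
    rw [mem_filter, q1Range, mem_filter, mem_Ioc] at a1
    rw [mem_filter, q2Range, mem_filter, mem_Ioc] at a2
    -- `p ≤ ⌊N^{5/7+δ}⌋ ≤ ⌊N^{6/7}⌋ < p` when `N ≥ 1`; when `N < 1` the first floor is `0`
    have hδ := hbδ_lt
    have hδ0 := hbδ_pos
    rcases le_or_gt 1 (Npar X) with hN1 | hN1
    · have hle : ⌊Npar X ^ ((5 : ℝ) / 7 + hbδ)⌋₊ ≤ ⌊Npar X ^ ((6 : ℝ) / 7)⌋₊ :=
        Nat.floor_le_floor (Real.rpow_le_rpow_of_exponent_le hN1 (by linarith))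
      omega
    · have h0 : ⌊Npar X ^ ((5 : ℝ) / 7 + hbδ)⌋₊ = 0 :=
        Nat.floor_eq_zero.mpr (Real.rpow_lt_one hN hN1 (by linarith))
      rw [h0] at a1
      have := a1.1.2.pos
      omega
  have hprime : ∀ p ∈ S₁ ∪ S₂, Prime p := by
    intro p hp
    rw [mem_union] at hp
    rcases hp with hp | hp
    · have := h₁ hp; rw [mem_filter, q1Range, mem_filter] at this; exact Nat.prime_iff.mp this.1.2
    · have := h₂ hp; rw [mem_filter, q2Range, mem_filter] at this; exact Nat.prime_iff.mp this.1.2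
  have hdvd : ∀ p ∈ S₁ ∪ S₂, p ∣ q := by
    intro p hp
    rw [mem_union] at hp
    rcases hp with hp | hp
    · have := h₁ hp; rw [mem_filter] at this; exact this.2
    · have := h₂ hp; rw [mem_filter] at this; exact this.2
  have hprod : ∏ p ∈ S₁ ∪ S₂, p ∣ q := Finset.prod_primes_dvd q hprime hdvd
  have hle : ((∏ p ∈ S₁ ∪ S₂, p : ℕ) : ℝ) ≤ q := by exact_mod_cast Nat.le_of_dvd hq hprod
  refine le_trans ?_ hle
  rw [prod_union hdisj]
  push_cast
  -- lower bounds: each `p ∈ S₁` is `> N^{5/7}`, each `p ∈ S₂` is `> N^{6/7}`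
  have hb1 : ∀ p ∈ S₁, Npar X ^ ((5 : ℝ) / 7) ≤ (p : ℝ) := by
    intro p hp
    have := h₁ hp; rw [mem_filter, q1Range, mem_filter, mem_Ioc] at this
    exact (Nat.floor_lt (by positivity)).mp this.1.1.1 |>.le
  have hb2 : ∀ p ∈ S₂, Npar X ^ ((6 : ℝ) / 7) ≤ (p : ℝ) := by
    intro p hp
    have := h₂ hp; rw [mem_filter, q2Range, mem_filter, mem_Ioc] at this
    exact (Nat.floor_lt (by positivity)).mp this.1.1.1 |>.le
  have hp1 : Npar X ^ ((5 : ℝ) / 7 * #S₁) ≤ ∏ p ∈ S₁, (p : ℝ) := by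
    rw [Real.rpow_mul hN, Real.rpow_natCast, ← prod_const]
    exact prod_le_prod (fun _ _ => by positivity) hb1
  have hp2 : Npar X ^ ((6 : ℝ) / 7 * #S₂) ≤ ∏ p ∈ S₂, (p : ℝ) := by
    rw [Real.rpow_mul hN, Real.rpow_natCast, ← prod_const]
    exact prod_le_prod (fun _ _ => by positivity) hb2
  rw [Real.rpow_add_of_nonneg hN (by positivity) (by positivity)]
  exact mul_le_mul hp1 hp2 (by positivity) (prod_nonneg fun _ _ => by positivity)

/-- **`mn ≤ 3`**: for `0 < q < N^{22/7}`, the numbers of `q₁ ∈ q1Range` and of `q₂ ∈ q2Range` dividing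
`q` have product at most `3`. [cite: HeathBrown2001LargestPrimeFactorCubic, §8 p. 31] -/
theorem card_q1_dvd_mul_card_q2_dvd_le {X q : ℕ} (hq : 0 < q) (hqN : (q : ℝ) < Npar X ^ ((22 : ℝ) / 7)) :
    #((q1Range X).filter (· ∣ q)) * #((q2Range X).filter (· ∣ q)) ≤ 3 := by
  set m := #((q1Range X).filter (· ∣ q)) with hm
  set n := #((q2Range X).filter (· ∣ q)) with hn
  have h := rpow_lt_of_primes_dvd hq _ _ (subset_refl ((q1Range X).filter (· ∣ q)))
    (subset_refl ((q2Range X).filter (· ∣ q)))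
  rw [← hm, ← hn] at h
  have hlt : Npar X ^ ((5 : ℝ) / 7 * m + (6 : ℝ) / 7 * n) < Npar X ^ ((22 : ℝ) / 7) := h.trans_lt hqN
  have hN := Npar_nonneg X
  -- `N > 1` necessarily (else `q < N^{22/7} ≤ 1`), and then the exponents compare
  have hN1 : 1 < Npar X := by
    by_contra hle
    push Not at hle
    have : Npar X ^ ((22 : ℝ) / 7) ≤ 1 := Real.rpow_le_one hN hle (by norm_num)
    have : (1 : ℝ) ≤ q := by exact_mod_cast hq
    linarith
  have hexp : (5 : ℝ) / 7 * m + (6 : ℝ) / 7 * n < (22 : ℝ) / 7 := by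
    by_contra hge
    push Not at hge
    have := Real.rpow_le_rpow_of_exponent_le hN1.le hge
    linarith
  apply five_mul_add_six_mul_lt
  have : (5 : ℝ) * m + 6 * n < 22 := by linarith
  exact_mod_cast this

/-- **Multiplicity at most `3`**: `#{(q₁, q₂) ∈ q1Range × q2Range : q₁q₂ ∣ q} ≤ 3` for `0 < q < N^{22/7}`.
[cite: HeathBrown2001LargestPrimeFactorCubic, §8 p. 31] -/
theorem card_pairs_dvd_le_three {X q : ℕ} (hq : 0 < q) (hqN : (q : ℝ) < Npar X ^ ((22 : ℝ) / 7)) :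
    #((q1Range X ×ˢ q2Range X).filter fun qq : ℕ × ℕ => qq.1 * qq.2 ∣ q) ≤ 3 := by
  have hsub : (q1Range X ×ˢ q2Range X).filter (fun qq : ℕ × ℕ => qq.1 * qq.2 ∣ q) ⊆
      (q1Range X).filter (· ∣ q) ×ˢ (q2Range X).filter (· ∣ q) := by
    intro qq hqq
    rw [mem_filter, mem_product] at hqq
    rw [mem_product, mem_filter, mem_filter]
    exact ⟨⟨hqq.1.1, (dvd_mul_right _ _).trans hqq.2⟩, ⟨hqq.1.2, (dvd_mul_left _ _).trans hqq.2⟩⟩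
  calc #((q1Range X ×ˢ q2Range X).filter fun qq : ℕ × ℕ => qq.1 * qq.2 ∣ q)
      ≤ #((q1Range X).filter (· ∣ q) ×ˢ (q2Range X).filter (· ∣ q)) := card_le_card hsub
    _ = #((q1Range X).filter (· ∣ q)) * #((q2Range X).filter (· ∣ q)) := card_product _ _
    _ ≤ 3 := card_q1_dvd_mul_card_q2_dvd_le hq hqN

end Literature.NumberTheory.Sieve.HeathBrown2001
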